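import Summits.CriticalPhenomena.Ising3DConformalLimit.Theses.PerfectScreening
import Literature.Probability.LatticeModels.GeneralisedFreeFamily
import Literature.Probability.LatticeModels.CorrelationDecayProofs
import Literature.Barriers.CriticalPhenomena.ScaleCovarianceNotMoebius

/-!
# `GaussianLimitNotScreened` (stmt-CriticalPhenomena-13886) is MODEL-BLIND-FALSE

Negative knowledge about the crux `…Theses.PerfectScreening.GaussianLimitNotScreened` (r4 of route
PerfectScreening), standing crux disprover (D-0016); THEOREM-ONLY, supports the item, closes nothing.

The crux says: a non-degenerate, Möbius-covariant, Gaussian (`U₄ ≡ 0`) pointwise scaling limit of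
`criticalCorr 3` forbids perfect screening `‖x‖·⟨σ₀σ_x⟩_{β_c} → 0`. Here we prove that the same
statement with `criticalCorr 3` replaced by an ARBITRARY lattice family `G : LatticeCorrFamily 3`
(`CruxWithoutIsing`) is FALSE (`cruxWithoutIsing_false`). Witness (`screenedLattice`): the Wick
family on `ℤ³` of the screened Coulomb kernel `g(a,b) = ‖a-b‖₂⁻¹ (1 + log ‖a-b‖₂)⁻¹`; under the
renormalisation `renorm δ = √((1 - log δ)/δ)` its pointwise scaling limit is the massless free field
`gffFamily (1/2)` of `Literature/Probability/LatticeModels/GeneralisedFreeFamily.lean` (Möbius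
covariant with `Δ = 1/2`, non-degenerate, `U₄ ≡ 0`) — `screenedLattice_hasLimit` — while
`‖x‖ g(0,x) ≤ (1 + log ‖x‖)⁻¹ → 0` — `screenedLattice_screened`. The slowly varying amplitude
`(1 + log(r/δ))⁻¹ ∼ (log(1/δ))⁻¹` is absorbed by `ρ` and invisible to the limit.

Consequence for provers: r4 cannot be proved from limit-side information (Newman-Gaussianity,
Möbius/Pitt–Kotani rigidity at `Δ = 1/2`) plus the existence of the limit; the proof must use a
property of the critical Ising MEASURE not shared by this witness (see the crux work file
`Cruxes/GaussianLimitNotScreened/Disproof.lean` for the sharpened version with translation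
invariance, lattice Gaussianity and the Simon–Lieb/FSS window, and for the paper-level examples).
Tools reused: `ScaleNotMoebius.tendstoLocallyUniformlyOn_comp_approx`, `dist_round_le`,
Mathlib `TendstoLocallyUniformlyOn.mul₀/.add`.
-/

noncomputable section

namespace Summit.CriticalPhenomena.Ising3DConformalLimit.GaussianLimitNotScreenedNegative

open Literature.Probability.LatticeModels Filter Topology Metric
open Literature.Barriers.CriticalPhenomena.ScaleNotMoebius (tendstoLocallyUniformlyOn_comp_approx dist_round_le norm_smul_toLp_latticeApprox_sub_le tendstoLocallyUniformlyOn_congr_eventually)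
/-! ## The screened Wick witness on `ℤ³` -/
/-- The embedding `ℤ³ ↪ ℝ³`. [folklore] -/
def ι (k : Site 3) : EuclideanSpace ℝ (Fin 3) := WithLp.toLp 2 fun j => (k j : ℝ)

/-- Coordinates of `ι`. [folklore] -/
@[simp] theorem ι_apply (k : Site 3) (j : Fin 3) : ι k j = (k j : ℝ) := rfl
/-- `ι 0 = 0`. [folklore] -/
@[simp] theorem ι_zero : ι (0 : Site 3) = 0 := by
  ext j; simp [ι]

/-- The screened radial profile `φ(r) = 1 / (r (1 + log r))` (junk `0` at `r = 0`). [folklore] -/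
def phi (r : ℝ) : ℝ := r⁻¹ * (1 + Real.log r)⁻¹

/-- The lattice pair kernel `g(a,b) = φ(‖a - b‖₂)`: `‖x‖₂⁻¹ (1 + log ‖x‖₂)⁻¹`, a perfectly
SCREENED Coulomb potential (`‖x‖ g → 0`) which is still regularly varying of index `-1`. [folklore] -/
def gL (a b : Site 3) : ℝ := phi ‖ι a - ι b‖

/-- The Wick (Gaussian) family generated by a pair kernel: `n = 2 ↦ K`, `n = 4 ↦` the three
pairings, every other arity `0`. [folklore] -/
def wickFamily {α : Type*} (K : α → α → ℝ) : (n : ℕ) → (Fin n → α) → ℝ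
  | 2, x => K (x 0) (x 1)
  | 4, x => K (x 0) (x 1) * K (x 2) (x 3) + K (x 0) (x 2) * K (x 1) (x 3) +
      K (x 0) (x 3) * K (x 1) (x 2)
  | _, _ => 0

/-- THE LATTICE WITNESS: the Wick family of the screened kernel `gL` on `ℤ³`. [folklore] -/
def screenedLattice : LatticeCorrFamily 3 := wickFamily gL

/-- Its renormalisation `ρ(δ) = √((1 - log δ)/δ)` (`= √(log(e/δ)/δ)`, i.e. `δ^{-1/2}` times a
slowly varying factor tending to `∞`). [folklore] -/
def renorm (δ : ℝ) : ℝ := Real.sqrt ((1 - Real.log δ) / δ)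

/-- The level-`L` comparison profile `ψ_L(R) = R⁻¹ · L/(L + log R)` (`→ R⁻¹` as `L → ∞`). [folklore] -/
def psi (L R : ℝ) : ℝ := R⁻¹ * (L * (L + Real.log R)⁻¹)

/-- `ρ(δ) > 0` on `(0,1]`. [folklore] -/
theorem renorm_pos {δ : ℝ} (hδ : 0 < δ) (hδ1 : δ ≤ 1) : 0 < renorm δ := by
  unfold renorm
  apply Real.sqrt_pos.2
  have : Real.log δ ≤ 0 := Real.log_nonpos hδ.le hδ1
  exact div_pos (by linarith) hδ

/-- `ρ(δ)² = (1 - log δ)/δ` on `(0,1]`. [folklore] -/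
theorem renorm_sq {δ : ℝ} (hδ : 0 < δ) (hδ1 : δ ≤ 1) : renorm δ ^ 2 = (1 - Real.log δ) / δ := by
  unfold renorm
  have : Real.log δ ≤ 0 := Real.log_nonpos hδ.le hδ1
  exact Real.sq_sqrt (div_nonneg (by linarith) hδ.le)

/-- KEY ALGEBRA: `ρ(δ)² φ(r) = ψ_{1 - log δ}(δ r)` for `0 < δ ≤ 1` and every real `r`. [folklore] -/
theorem renorm_sq_mul_phi {δ : ℝ} (hδ : 0 < δ) (hδ1 : δ ≤ 1) (r : ℝ) :
    renorm δ ^ 2 * phi r = psi (1 - Real.log δ) (δ * r) := by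
  rw [renorm_sq hδ hδ1, phi, psi]
  rcases eq_or_ne r 0 with rfl | hr
  · simp
  · rw [Real.log_mul hδ.ne' hr, mul_inv]
    field_simp
    ring

/-- The rescaled witness correlator at mesh `δ ∈ (0,1]` IS the level-`(1 - log δ)` comparison Wick
family evaluated at the rounded configuration `δ[x/δ]`. [folklore] -/
theorem rescaledCorrelator_screenedLattice {δ : ℝ} (hδ : 0 < δ) (hδ1 : δ ≤ 1) (n : ℕ)
    (x : Fin n → EuclideanSpace ℝ (Fin 3)) :
    rescaledCorrelator screenedLattice renorm n δ x =
      wickFamily (fun a b : EuclideanSpace ℝ (Fin 3) => psi (1 - Real.log δ) ‖a - b‖) n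
        (fun i => δ • ι (latticeApprox δ (x i))) := by
  have hpair : ∀ a b : Site 3, renorm δ ^ 2 * gL a b =
      psi (1 - Real.log δ) ‖δ • ι a - δ • ι b‖ := by
    intro a b
    rw [gL, renorm_sq_mul_phi hδ hδ1, ← smul_sub, norm_smul, Real.norm_eq_abs, abs_of_pos hδ]
  rw [rescaledCorrelator_apply]
  match n with
  | 0 => simp [screenedLattice, wickFamily]
  | 1 => simp [screenedLattice, wickFamily]
  | 2 =>
    simp only [screenedLattice, wickFamily]
    rw [← hpair]
  | 3 => simp [screenedLattice, wickFamily]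
  | 4 =>
    simp only [screenedLattice, wickFamily]
    rw [← hpair, ← hpair, ← hpair, ← hpair, ← hpair, ← hpair]
    ring
  | _ + 5 => simp [screenedLattice, wickFamily]

/-! ### The witness two-point function is perfectly screened -/
/-- Sup norm ≤ Euclidean norm for integer points. [folklore] -/
theorem norm_le_norm_ι (x : Site 3) : ‖x‖ ≤ ‖ι x‖ := by
  rw [pi_norm_le_iff_of_nonneg (norm_nonneg _)]
  intro j
  have h : ‖(ι x) j‖ ≤ ‖ι x‖ := PiLp.norm_apply_le (ι x) j
  have e : ‖(ι x) j‖ = ‖x j‖ := by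
    rw [ι_apply, Int.norm_cast_real]
  rwa [e] at h

/-- A nonzero integer point has Euclidean norm `≥ 1`. [folklore] -/
theorem one_le_norm_ι {x : Site 3} (hx : x ≠ 0) : 1 ≤ ‖ι x‖ := by
  have h1 : (1 : ℝ) ≤ ‖x‖ := by
    obtain ⟨j, hj⟩ : ∃ j, x j ≠ 0 := by
      by_contra hall; push Not at hall; exact hx (funext hall)
    calc (1 : ℝ) ≤ ‖x j‖ := by
          rw [Int.norm_eq_abs]; exact_mod_cast Int.one_le_abs hj
      _ ≤ ‖x‖ := norm_le_pi_norm x j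
  exact h1.trans (norm_le_norm_ι x)

/-- `G₂(0,x) = φ(‖x‖₂)`. [folklore] -/
theorem screenedLattice_two (x : Site 3) : screenedLattice 2 ![0, x] = phi ‖ι x‖ := by
  simp [screenedLattice, wickFamily, gL, norm_neg]

/-- `‖x‖ · G₂(0,x) ≤ (1 + log ‖x‖)⁻¹` for `x ≠ 0`. [folklore] -/
theorem norm_mul_screenedLattice_two_le {x : Site 3} (hx : x ≠ 0) :
    ‖x‖ * screenedLattice 2 ![0, x] ≤ (1 + Real.log ‖x‖)⁻¹ := by
  rw [screenedLattice_two, phi]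
  have h1 := one_le_norm_ι hx
  have hx1 : (1:ℝ) ≤ ‖x‖ := by
    obtain ⟨j, hj⟩ : ∃ j, x j ≠ 0 := by
      by_contra hall; push Not at hall; exact hx (funext hall)
    calc (1 : ℝ) ≤ ‖x j‖ := by
          rw [Int.norm_eq_abs]; exact_mod_cast Int.one_le_abs hj
      _ ≤ ‖x‖ := norm_le_pi_norm x j
  have hlog0 : 0 ≤ Real.log ‖x‖ := Real.log_nonneg hx1
  have hlog : Real.log ‖x‖ ≤ Real.log ‖ι x‖ := Real.log_le_log (by linarith) (norm_le_norm_ι x)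
  have hpos : 0 < ‖ι x‖ := by linarith
  calc ‖x‖ * (‖ι x‖⁻¹ * (1 + Real.log ‖ι x‖)⁻¹)
      = (‖x‖ / ‖ι x‖) * (1 + Real.log ‖ι x‖)⁻¹ := by ring
    _ ≤ 1 * (1 + Real.log ‖x‖)⁻¹ := by
        have hA : ‖x‖ / ‖ι x‖ ≤ 1 := (div_le_one hpos).2 (norm_le_norm_ι x)
        have hB : (1 + Real.log ‖ι x‖)⁻¹ ≤ (1 + Real.log ‖x‖)⁻¹ :=
          inv_anti₀ (by linarith) (by linarith)
        have hC : 0 ≤ (1 + Real.log ‖ι x‖)⁻¹ := inv_nonneg.2 (by linarith)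
        have hD : 0 ≤ ‖x‖ / ‖ι x‖ := by positivity
        nlinarith
    _ = (1 + Real.log ‖x‖)⁻¹ := one_mul _

/-- `G₂(0,x) ≥ 0`. [folklore] -/
theorem screenedLattice_two_nonneg (x : Site 3) : 0 ≤ screenedLattice 2 ![0, x] := by
  rw [screenedLattice_two, phi]
  rcases eq_or_ne x 0 with rfl | hx
  · simp
  · have h1 := one_le_norm_ι hx
    have : 0 ≤ Real.log ‖ι x‖ := Real.log_nonneg h1
    positivity

/-- **The witness is perfectly screened**: `‖x‖ · G₂(0,x) → 0` along the cofinite filter of `ℤ³`. [folklore] -/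
theorem screenedLattice_screened :
    Tendsto (fun x : Site 3 => ‖x‖ * screenedLattice 2 ![0, x]) cofinite (𝓝 0) := by
  have hlog : Tendsto (fun x : Site 3 => (1 + Real.log ‖x‖)⁻¹) cofinite (𝓝 0) := by
    have h1 : Tendsto (fun x : Site 3 => 1 + Real.log ‖x‖) cofinite atTop :=
      tendsto_atTop_add_const_left _ 1
        (Real.tendsto_log_atTop.comp Site.tendsto_norm_cofinite_atTop)
    exact h1.inv_tendsto_atTop
  refine squeeze_zero' ?_ ?_ hlog
  · exact Eventually.of_forall fun x => mul_nonneg (norm_nonneg _) (screenedLattice_two_nonneg x)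
  · have hne : ∀ᶠ x : Site 3 in cofinite, x ≠ 0 := by
      have : {x : Site 3 | x ≠ 0}ᶜ.Finite := by simp
      exact this
    exact hne.mono fun x hx => norm_mul_screenedLattice_two_le hx

/-! ### The scaling limit of the witness is the massless free field `gffFamily (1/2)` -/
/-- The level `1 - log δ → +∞` as `δ → 0⁺`. [folklore] -/
theorem tendsto_level : Tendsto (fun δ : ℝ => 1 - Real.log δ) (𝓝[>] 0) atTop := by
  have h2 : Tendsto (fun δ : ℝ => -Real.log δ) (𝓝[>] 0) atTop :=
    tendsto_neg_atBot_atTop.comp Real.tendsto_log_nhdsGT_zero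
  have h3 := tendsto_atTop_add_const_left _ (1:ℝ) h2
  simpa [sub_eq_add_neg] using h3

/-- The rounded configuration `δ[x/δ]`. [folklore] -/
def roundCfg {n : ℕ} (δ : ℝ) (x : Fin n → EuclideanSpace ℝ (Fin 3)) : Fin n → EuclideanSpace ℝ (Fin 3) :=
  fun i => δ • ι (latticeApprox δ (x i))

/-- Rounding moves a configuration by at most `3δ`. [folklore] -/
theorem dist_roundCfg_le {n : ℕ} {δ : ℝ} (hδ : 0 < δ) (x : Fin n → EuclideanSpace ℝ (Fin 3)) :
    dist (roundCfg δ x) x ≤ 3 * δ :=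
  dist_round_le hδ x

/-- Rounding moves each point by at most `3δ`. [folklore] -/
theorem norm_roundCfg_sub_le {n : ℕ} {δ : ℝ} (hδ : 0 < δ) (x : Fin n → EuclideanSpace ℝ (Fin 3))
    (i : Fin n) : ‖roundCfg δ x i - x i‖ ≤ 3 * δ :=
  norm_smul_toLp_latticeApprox_sub_le hδ (x i)

/-- `x ↦ ‖xᵢ - xⱼ‖⁻¹` is continuous on non-coincident configurations. [folklore] -/
theorem continuousOn_inv_dist {n : ℕ} (i j : Fin n) (hij : i ≠ j) :
    ContinuousOn (fun x : Fin n → EuclideanSpace ℝ (Fin 3) => ‖x i - x j‖⁻¹) (NonCoincident 3 n) := by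
  refine ContinuousOn.inv₀ (by fun_prop) fun x hx => ?_
  exact norm_ne_zero_iff.2 (sub_ne_zero.2 (((mem_nonCoincident x).1 hx).ne hij))

/-- (i) `‖δ[xᵢ/δ] - δ[xⱼ/δ]‖⁻¹ → ‖xᵢ - xⱼ‖⁻¹` locally uniformly. [folklore] -/
theorem tendsto_inv_dist_round {n : ℕ} (i j : Fin n) (hij : i ≠ j) :
    TendstoLocallyUniformlyOn (fun δ x => ‖roundCfg δ x i - roundCfg δ x j‖⁻¹)
      (fun x : Fin n → EuclideanSpace ℝ (Fin 3) => ‖x i - x j‖⁻¹) (𝓝[>] 0) (NonCoincident 3 n) :=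
  tendstoLocallyUniformlyOn_comp_approx (isOpen_nonCoincident 3 n)
    (f := fun x : Fin n → EuclideanSpace ℝ (Fin 3) => ‖x i - x j‖⁻¹)
    (continuousOn_inv_dist i j hij) (fun δ x => roundCfg δ x) 3 (fun _ hδ x => dist_roundCfg_le hδ x)

/-- The logarithmic correction factor `q_L(R) = L/(L + log R)`. [folklore] -/
def qfac (L R : ℝ) : ℝ := L * (L + Real.log R)⁻¹

/-- `ψ_L(R) = R⁻¹ q_L(R)`. [folklore] -/
theorem psi_eq (L R : ℝ) : psi L R = R⁻¹ * qfac L R := rfl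
/-- `|q_L(R) - 1| ≤ B/(L - B)` when `|log R| ≤ B < L`. [folklore] -/
theorem abs_qfac_sub_one_le {L R B : ℝ} (hB : |Real.log R| ≤ B) (hL : B < L) :
    |qfac L R - 1| ≤ B / (L - B) := by
  have hlo := neg_abs_le (Real.log R)
  have hhi := le_abs_self (Real.log R)
  have hden : 0 < L + Real.log R := by linarith
  have hLB : 0 < L - B := by linarith
  have hq : qfac L R - 1 = -Real.log R / (L + Real.log R) := by
    unfold qfac
    field_simp
    ring
  rw [hq, abs_div, abs_neg, abs_of_pos hden, div_le_div_iff₀ hden hLB]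
  have hB0 : 0 ≤ B := (abs_nonneg _).trans hB
  nlinarith [abs_nonneg (Real.log R)]

/-- (ii) `q_{1 - log δ}(‖δ[xᵢ/δ] - δ[xⱼ/δ]‖) → 1` locally uniformly on non-coincident
configurations (the slowly varying factor is invisible in the limit). [folklore] -/
theorem tendsto_qfac_round {n : ℕ} (i j : Fin n) (hij : i ≠ j) :
    TendstoLocallyUniformlyOn
      (fun δ x => qfac (1 - Real.log δ) ‖roundCfg δ x i - roundCfg δ x j‖)
      (fun _ : Fin n → EuclideanSpace ℝ (Fin 3) => (1:ℝ)) (𝓝[>] 0) (NonCoincident 3 n) := by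
  rw [Metric.tendstoLocallyUniformlyOn_iff]
  intro ε hε x₀ hx₀
  have hd0 : 0 < ‖x₀ i - x₀ j‖ :=
    norm_pos_iff.2 (sub_ne_zero.2 (((mem_nonCoincident x₀).1 hx₀).ne hij))
  set d₀ := ‖x₀ i - x₀ j‖ with hd₀_def
  set t := {y : Fin n → EuclideanSpace ℝ (Fin 3) | ‖(y i - y j) - (x₀ i - x₀ j)‖ < d₀ / 2} with ht_def
  have ht_open : IsOpen t := isOpen_lt (by fun_prop) continuous_const
  have hx₀t : x₀ ∈ t := by
    show ‖(x₀ i - x₀ j) - (x₀ i - x₀ j)‖ < d₀ / 2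
    rw [sub_self, norm_zero]; positivity
  refine ⟨t, mem_nhdsWithin_of_mem_nhds (ht_open.mem_nhds hx₀t), ?_⟩
  set B := max |Real.log (d₀ / 4)| |Real.log (2 * d₀)| with hB_def
  have hB0 : 0 ≤ B := le_max_of_le_left (abs_nonneg _)
  have hev1 : ∀ᶠ δ in 𝓝[>] (0:ℝ), 0 < δ ∧ δ < d₀ / 24 := by
    filter_upwards [Ioo_mem_nhdsGT (show (0:ℝ) < d₀ / 24 by positivity)] with δ hδ
    exact ⟨hδ.1, hδ.2⟩
  have hev2 : ∀ᶠ δ in 𝓝[>] (0:ℝ), B + B / ε + 1 < 1 - Real.log δ :=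
    tendsto_level.eventually_gt_atTop _
  filter_upwards [hev1, hev2] with δ hδ hL y hy
  obtain ⟨hδ0, hδd⟩ := hδ
  -- the rounded pair distance R stays in [d₀/4, 2 d₀]
  set R := ‖roundCfg δ y i - roundCfg δ y j‖ with hR_def
  have hy' : ‖(y i - y j) - (x₀ i - x₀ j)‖ < d₀ / 2 := hy
  have hu_lo : d₀ / 2 < ‖y i - y j‖ := by
    have := norm_sub_norm_le (x₀ i - x₀ j) (y i - y j)
    rw [norm_sub_rev] at hy'
    linarith
  have hu_hi : ‖y i - y j‖ < 3 * d₀ / 2 := by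
    have := norm_le_insert' (y i - y j) (x₀ i - x₀ j)
    linarith
  have hRi := norm_roundCfg_sub_le hδ0 y i
  have hRj := norm_roundCfg_sub_le hδ0 y j
  have hRdiff : |R - ‖y i - y j‖| ≤ 6 * δ := by
    have h1 : |R - ‖y i - y j‖| ≤ ‖(roundCfg δ y i - roundCfg δ y j) - (y i - y j)‖ :=
      abs_norm_sub_norm_le _ _
    have h2 : ‖(roundCfg δ y i - roundCfg δ y j) - (y i - y j)‖ ≤ 3 * δ + 3 * δ := by
      calc ‖(roundCfg δ y i - roundCfg δ y j) - (y i - y j)‖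
          = ‖(roundCfg δ y i - y i) - (roundCfg δ y j - y j)‖ := by congr 1; abel
        _ ≤ ‖roundCfg δ y i - y i‖ + ‖roundCfg δ y j - y j‖ := norm_sub_le _ _
        _ ≤ 3 * δ + 3 * δ := add_le_add hRi hRj
    linarith
  have hRlo : d₀ / 4 ≤ R := by
    have := neg_abs_le (R - ‖y i - y j‖); linarith
  have hRhi : R ≤ 2 * d₀ := by
    have := le_abs_self (R - ‖y i - y j‖); linarith
  have hRpos : 0 < R := by linarith
  have hlogR : |Real.log R| ≤ B := by
    have h1 : Real.log (d₀ / 4) ≤ Real.log R := Real.log_le_log (by positivity) hRlo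
    have h2 : Real.log R ≤ Real.log (2 * d₀) := Real.log_le_log hRpos hRhi
    exact abs_le_max_abs_abs h1 h2
  have hBL : B < 1 - Real.log δ := by
    have : 0 ≤ B / ε := by positivity
    linarith
  rw [dist_comm, Real.dist_eq]
  calc |qfac (1 - Real.log δ) R - 1| ≤ B / (1 - Real.log δ - B) := abs_qfac_sub_one_le hlogR hBL
    _ < ε := by
        rw [div_lt_iff₀ (by linarith)]
        have h1 : B / ε < 1 - Real.log δ - B := by linarith
        have h2 := (div_lt_iff₀ hε).1 h1
        linarith

/-- (iii) The rescaled pair function converges: `ψ_{1-log δ}(‖δ[xᵢ/δ] - δ[xⱼ/δ]‖) → ‖xᵢ - xⱼ‖⁻¹`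
locally uniformly on non-coincident configurations. [folklore] -/
theorem tendsto_pair {n : ℕ} (i j : Fin n) (hij : i ≠ j) :
    TendstoLocallyUniformlyOn
      (fun δ x => psi (1 - Real.log δ) ‖roundCfg δ x i - roundCfg δ x j‖)
      (fun x : Fin n → EuclideanSpace ℝ (Fin 3) => ‖x i - x j‖⁻¹) (𝓝[>] 0) (NonCoincident 3 n) := by
  have h := (tendsto_inv_dist_round i j hij).mul₀ (tendsto_qfac_round i j hij)
    (continuousOn_inv_dist i j hij) continuousOn_const
  refine (h.congr fun δ x _ => ?_).congr_right fun x _ => ?_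
  · simp only [Pi.mul_apply, psi_eq]
  · simp only [Pi.mul_apply, mul_one]

/-- `gffTwo (1/2) a b = ‖a - b‖⁻¹`. [folklore] -/
theorem gffTwo_half (a b : EuclideanSpace ℝ (Fin 3)) : gffTwo (1/2) a b = ‖a - b‖⁻¹ := by
  rw [gffTwo, show (-(2 * (1/2 : ℝ))) = -1 by norm_num, Real.rpow_neg_one]

/-- `gffTwo 2⁻¹ a b = ‖a - b‖⁻¹` (simp-normal form of `gffTwo_half`). [folklore] -/
theorem gffTwo_half' (a b : EuclideanSpace ℝ (Fin 3)) : gffTwo 2⁻¹ a b = ‖a - b‖⁻¹ := by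
  rw [← gffTwo_half, one_div]

/-- **The screened lattice witness has the massless free field as pointwise scaling limit**:
`HasPointwiseScalingLimit screenedLattice renorm (gffFamily (1/2))`. [folklore] -/
theorem screenedLattice_hasLimit :
    HasPointwiseScalingLimit screenedLattice renorm (gffFamily (1/2)) := by
  intro n
  have hev : ∀ᶠ δ in 𝓝[>] (0:ℝ), Set.EqOn
      (fun x => wickFamily (fun a b : EuclideanSpace ℝ (Fin 3) => psi (1 - Real.log δ) ‖a - b‖) n
        (roundCfg δ x))
      (rescaledCorrelator screenedLattice renorm n δ) (NonCoincident 3 n) := by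
    filter_upwards [Ioc_mem_nhdsGT (zero_lt_one' ℝ)] with δ hδ x _
    exact (rescaledCorrelator_screenedLattice hδ.1 hδ.2 n x).symm
  refine tendstoLocallyUniformlyOn_congr_eventually ?_ hev
  have hzero : TendstoLocallyUniformlyOn (fun (_ : ℝ) (_ : Fin n → EuclideanSpace ℝ (Fin 3)) => (0:ℝ))
      (fun _ => 0) (𝓝[>] 0) (NonCoincident 3 n) :=
    ((tendsto_const_nhds (x := (0:ℝ))).tendstoUniformlyOn_const (NonCoincident 3 n)).tendstoLocallyUniformlyOn
  match n with
  | 0 => exact (hzero.congr fun δ x _ => by simp [wickFamily]).congr_right fun x _ => by simp [gffFamily]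
  | 1 => exact (hzero.congr fun δ x _ => by simp [wickFamily]).congr_right fun x _ => by simp [gffFamily]
  | 2 =>
    refine ((tendsto_pair (n := 2) 0 1 (by decide)).congr fun δ x _ => rfl).congr_right fun x _ => ?_
    simp [gffFamily, gffTwo_half']
  | 3 => exact (hzero.congr fun δ x _ => by simp [wickFamily]).congr_right fun x _ => by simp [gffFamily]
  | 4 =>
    have P := fun (i j : Fin 4) (hij : i ≠ j) => tendsto_pair (n := 4) i j hij
    have C := fun (i j : Fin 4) (hij : i ≠ j) => continuousOn_inv_dist (n := 4) i j hij
    have h := ((((P 0 1 (by decide)).mul₀ (P 2 3 (by decide)) (C 0 1 (by decide)) (C 2 3 (by decide))).add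
      ((P 0 2 (by decide)).mul₀ (P 1 3 (by decide)) (C 0 2 (by decide)) (C 1 3 (by decide)))).add
      ((P 0 3 (by decide)).mul₀ (P 1 2 (by decide)) (C 0 3 (by decide)) (C 1 2 (by decide))))
    refine (h.congr fun δ x _ => ?_).congr_right fun x _ => ?_
    · simp only [Pi.add_apply, Pi.mul_apply, wickFamily]
    · simp only [Pi.add_apply, Pi.mul_apply, gffFamily, gffTwo_half]
  | _ + 5 =>
    exact (hzero.congr fun δ x _ => by simp [wickFamily]).congr_right fun x _ => by simp [gffFamily]

/-! ## (a1) Load-bearing hypothesis №1: the lattice family must be `criticalCorr 3` itself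

The crux with the Ising correlators `criticalCorr 3` replaced by an ARBITRARY lattice family `G`
(and `criticalTwoPoint 3 x = criticalCorr 3 2 ![0,x]`, tree lemma `criticalCorr_two`, replaced by
`G 2 ![0,x]`). -/

/-- The model-blind form of the crux: for EVERY lattice family `G`, a non-degenerate Möbius-covariant
Gaussian pointwise scaling limit forbids perfect screening of `G₂`. [folklore] -/
def CruxWithoutIsing : Prop :=
  ∀ (G : LatticeCorrFamily 3) (ρ : ℝ → ℝ) (Δ : ℝ) (S : CorrFamily 3), (∀ δ ∈ Set.Ioc (0:ℝ) 1, 0 < ρ δ) →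
    HasPointwiseScalingLimit G ρ S → IsNondegenerateTwoPoint S → IsMoebiusCovariant Δ S →
    ¬ HasNontrivialU4 S →
    ¬ Tendsto (fun x : Site 3 => ‖x‖ * G 2 ![0, x]) cofinite (𝓝 0)

/-- **`¬ CruxWithoutIsing` — any proof of the crux must use a property of the critical Ising
correlators beyond "having a non-degenerate, Möbius-covariant (Δ = 1/2), Gaussian pointwise scaling
limit".** Witness: the screened Wick family `screenedLattice` (`G₂(0,x) = ‖x‖₂⁻¹(1 + log ‖x‖₂)⁻¹`,
`G₄` = Wick, other arities `0`), renormalisation `ρ(δ) = √(log(e/δ)/δ)`, limit = the massless free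
field `gffFamily (1/2)` (Möbius covariant, non-degenerate, `U₄ ≡ 0`), yet `‖x‖ G₂(0,x) → 0`. [folklore] -/
theorem cruxWithoutIsing_false : ¬ CruxWithoutIsing := by
  intro h
  exact h screenedLattice renorm (1/2) (gffFamily (1/2)) (fun δ hδ => renorm_pos hδ.1 hδ.2)
    screenedLattice_hasLimit (isNondegenerateTwoPoint_gff _) (isMoebiusCovariant_gff _)
    (not_hasNontrivialU4_gff _) screenedLattice_screened

end Summit.CriticalPhenomena.Ising3DConformalLimit.GaussianLimitNotScreenedNegative

end
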